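import Mathlib
import Summits.RiemannHypothesis.RiemannHypothesis.Theorems.TiltedLandingLaw421R3Lens1ValueCycle

/-! # PieceFramework-v1 — the PIECE FRAMEWORK of NODE v24 §3–§4 in the currency of `ValueCycle` (image X): pole-free piece lemma,
petal count `n_Π = 1 + desc − asc`, the decomposition identity `Z(ω) = Σ_Q n_Q(ω) = POLES + DESC(ω) − ASC(ω)`, «petal cover ⇒ cover»,
and the combinatorial half of CONJECTURE B «block descent ⇒ petal cover» (lens-1 g9; SUMMON O9-1)

PURE BOOKKEEPING over `RhW08.Lens1ValueCycle` (Mathlib + image X only; 0 sorries; SUPPORT (K) — no law is typed here).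
Dictionary (the analytic instantiation is NOT typed here; it is the socket of the next image): a PIECE FRAMEWORK is the finite family of
positive nodal cells `Q` of `Im φ` inside `D ∩ H⁺` (`D` the Jensen disc of the top zero `a`, slightly enlarged), each carrying the chained,
well-formed VALUE CYCLE of its boundary walk (cell on the left): RUNS = level arcs / NL base segments (real values, increasing), POLES = zeros of
`G = f^{(j)}` on `∂Q` (passage `⊤ → ⊥`), EXCURSIONS = arcs of the circle with `Im φ > 0` (= the `BadPiece`s of frame F, walked counter-clockwise,
start = value at the smaller angle).  The PETAL `Π` is the cell hanging from `a`; its cycle is indexed so that piece `0` is the pole `a`.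
* §1 one cell: `asc_le_desc_of_no_pole` (POLE-FREE PIECE LEMMA, count half), `runs_eq_of_one_pole` (PETAL COUNT `n_Π = 1 + desc − asc`),
  `finish_le_start_of_single_exc` (a pole-free cell with a single chord DESCENDS — the value form behind the GAP LEMMA and «blind lunes»).
* §2 frameworks: `PieceFramework.Z_eq` (`Z = POLES + DESC − ASC`), `covered_iff_one_le_Z`, `covered_iff_count`
  (`Covered ω ↔ ASC ω ≤ POLES − 1 + DESC ω` — the census form `#asc − #desc ≤ pz` of frame F's `ArcCountIneq` when `POLES = 1 + pz`),
  `covered_of_petalCoverAt` (★ PETAL COVER ⇒ COVER: the other cells contribute `n_Q ≥ 0`), `petalCoverAt_iff` (`1 ≤ n_Π ↔ asc_Π ≤ desc_Π` when `P_Π = 1`).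
* §3 CONJECTURE B, combinatorial half: a BLOCKING of the petal cycle (index blocks `[fst b, lst b]` away from the pole, ordered, every non-run
  piece other than the pole inside a block) with BLOCK DESCENT `finish (lst b) < start (fst b)` forces every generic level onto a run OUTSIDE the
  blocks (`exists_run_of_blockDescent`): the pole windows `(⊥, A_first(β₁))`, `(B_last(β_last), ⊤)` and the inter-block windows overlap consecutively.
What stays OPEN (not typed here): the realisation socket (nodal cells of `Im φ` in the disc give such a framework whose excursions are the bad pieces
and whose pole count is `≤ 1 + pz`) and the located law «the petal alone covers» / CONJECTURE B itself (analytic; next image, on frames F/H/I).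
Nothing here bears on the truth of RH; RH is not proved; TopPinning / 33346 / 33347 OPEN; checked ≠ landed ≠ proved. -/

namespace RhW08.Lens1PieceFramework

open Finset RhW08.Lens1ValueCycle

variable {n : ℕ}

/-! ## §1 One cell: the pole-count forms of `runs_eq` -/

/-- (K) `desc(ω) ≥ 0`. -/
theorem sum_descAt_nonneg (c : ValueCycle n) (ω : ℝ) : 0 ≤ ∑ i, descAt ω c i :=
  Finset.sum_nonneg fun i _ => by unfold descAt downAt; split_ifs <;> simp

/-- (K) `runs(ω) ≥ 0`. -/
theorem sum_runsAt_nonneg (c : ValueCycle n) (ω : ℝ) : 0 ≤ ∑ i, runsAt ω c i :=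
  Finset.sum_nonneg fun i _ => (runsAt_le_one c ω i).2

/-- (K) no pole pieces ⇒ pole count `0`. -/
theorem sum_poleAt_eq_zero (c : ValueCycle n) (h : ∀ i, c.kind i ≠ PieceKind.pole) : ∑ i, poleAt c i = 0 :=
  Finset.sum_eq_zero fun i _ => by
    unfold poleAt; rcases hk : c.kind i with _ | _ | _ <;> simp_all [PieceKind.isPole]

/-- ★ (K) POLE-FREE PIECE LEMMA (count half; NODE v24 §3): a cell with no pole on its boundary has `asc(ω) ≤ desc(ω)` at every generic level. -/
theorem asc_le_desc_of_no_pole [NeZero n] (c : ValueCycle n) (hc : IsChained c) (hw : WellFormed c) {ω : ℝ} (hg : Generic ω c)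
    (hnp : ∀ i, c.kind i ≠ PieceKind.pole) : ∑ i, ascAt ω c i ≤ ∑ i, descAt ω c i := by
  have h := runs_eq c hc hw hg
  have h0 := sum_poleAt_eq_zero c hnp
  have hr := sum_runsAt_nonneg c ω
  linarith

/-- ★ (K) PETAL COUNT (NODE v24 §4): a cell with exactly one pole piece has `runs(ω) = 1 + desc(ω) − asc(ω)`. -/
theorem runs_eq_of_one_pole [NeZero n] (c : ValueCycle n) (hc : IsChained c) (hw : WellFormed c) {ω : ℝ} (hg : Generic ω c)
    (hP : ∑ i, poleAt c i = 1) : ∑ i, runsAt ω c i = 1 + ∑ i, descAt ω c i - ∑ i, ascAt ω c i := by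
  have h := runs_eq c hc hw hg
  rw [hP] at h
  linarith

/-- (K) a pole-free cell with a single excursion piece `e` (every other piece a run): `e` ascends past no generic level. -/
theorem not_asc_of_single_exc [NeZero n] (c : ValueCycle n) (hc : IsChained c) (hw : WellFormed c) {ω : ℝ} (hg : Generic ω c)
    {e : Fin n} (hexc : c.kind e = PieceKind.exc) (hrun : ∀ i, i ≠ e → c.kind i = PieceKind.run) :
    ¬ (c.start e < ω ∧ (ω : EReal) < c.finish e) := by
  intro hasc
  have hnp : ∀ i, c.kind i ≠ PieceKind.pole := by
    intro i
    by_cases hi : i = e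
    · rw [hi, hexc]; exact fun h => PieceKind.noConfusion h
    · rw [hrun i hi]; exact fun h => PieceKind.noConfusion h
  have h := asc_le_desc_of_no_pole c hc hw hg hnp
  have ha : 1 ≤ ∑ i, ascAt ω c i := by
    have h1 : ascAt ω c e = 1 := by
      unfold ascAt upAt; rw [hexc]; simp [PieceKind.isExc, hasc]
    have h2 : ascAt ω c e ≤ ∑ i, ascAt ω c i :=
      Finset.single_le_sum (fun i _ => by unfold ascAt upAt; split_ifs <;> simp) (Finset.mem_univ e)
    linarith
  have hd : ∑ i, descAt ω c i = 0 := Finset.sum_eq_zero fun i _ => by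
    by_cases hi : i = e
    · rw [hi]; unfold descAt downAt
      rw [if_neg (fun hdn : c.finish e < ω ∧ (ω : EReal) < c.start e => lt_asymm (hasc.1.trans hasc.2) (hdn.1.trans hdn.2))]
      split_ifs <;> rfl
    · unfold descAt; rw [hrun i hi]; simp [PieceKind.isExc]
  linarith

/-- (K) between two distinct `EReal` values lies a real level that is generic for the cycle (endpoint values are finitely many). -/
theorem exists_generic_btwn (c : ValueCycle n) {s f : EReal} (h : s < f) : ∃ ω : ℝ, Generic ω c ∧ s < ω ∧ (ω : EReal) < f := by
  obtain ⟨r₁, hr₁, hr₁'⟩ := EReal.exists_between_coe_real h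
  obtain ⟨r₂, hr₂, hr₂'⟩ := EReal.exists_between_coe_real hr₁'
  have hlt : r₁ < r₂ := by exact_mod_cast hr₂
  let bad : Set ℝ := ⋃ i : Fin n, ({ω : ℝ | (ω : EReal) = c.start i} ∪ {ω : ℝ | (ω : EReal) = c.finish i})
  have hbad : bad.Finite := by
    refine Set.finite_iUnion fun i => Set.Finite.union ?_ ?_
    · exact Set.Subsingleton.finite fun x hx y hy => EReal.coe_injective (Eq.trans hx (Eq.symm hy))
    · exact Set.Subsingleton.finite fun x hx y hy => EReal.coe_injective (Eq.trans hx (Eq.symm hy))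
  obtain ⟨ω, ⟨hω₁, hω₂⟩, hωb⟩ := ((Set.Ioo_infinite hlt).sdiff hbad).nonempty
  refine ⟨ω, fun i => ⟨fun he => hωb ?_, fun he => hωb ?_⟩, ?_, ?_⟩
  · exact Set.mem_iUnion.2 ⟨i, Or.inl he⟩
  · exact Set.mem_iUnion.2 ⟨i, Or.inr he⟩
  · exact hr₁.trans (by exact_mod_cast hω₁)
  · exact lt_trans (by exact_mod_cast hω₂) hr₂'

/-- ★ (K) SINGLE-CHORD DESCENT (value form of NODE v24 §3: the GAP LEMMA read on the reversed walk of a negative cell, and «a pole-free cell with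
one chord descends»): a chained well-formed cycle with no pole and a single excursion piece `e` has `finish e ≤ start e`. -/
theorem finish_le_start_of_single_exc [NeZero n] (c : ValueCycle n) (hc : IsChained c) (hw : WellFormed c)
    {e : Fin n} (hexc : c.kind e = PieceKind.exc) (hrun : ∀ i, i ≠ e → c.kind i = PieceKind.run) : c.finish e ≤ c.start e := by
  by_contra hlt
  obtain ⟨ω, hg, h1, h2⟩ := exists_generic_btwn c (not_le.1 hlt)
  exact not_asc_of_single_exc c hc hw hg hexc hrun ⟨h1, h2⟩

/-! ## §2 Piece frameworks: the decomposition identity and «petal cover ⇒ cover» -/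

/-- A PIECE FRAMEWORK: finitely many cells, cell `p` carrying a chained well-formed boundary value cycle with `sz p + 1` pieces. -/
structure PieceFramework where
  /-- number of cells -/
  m : ℕ
  /-- the boundary cycle of cell `p` has `sz p + 1` pieces -/
  sz : Fin m → ℕ
  /-- the boundary value cycle of cell `p` -/
  cyc : (p : Fin m) → ValueCycle (sz p + 1)
  /-- every cycle is chained -/
  chained : ∀ p, IsChained (cyc p)
  /-- every cycle is well formed -/
  wellFormed : ∀ p, WellFormed (cyc p)

namespace PieceFramework

variable (F : PieceFramework)

/-- `ω` is generic for every cell. -/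
def GenericF (ω : ℝ) : Prop := ∀ p, Generic ω (F.cyc p)

/-- `n_Q(ω)`: the run count of cell `p` at level `ω`. -/
noncomputable def nQ (ω : ℝ) (p : Fin F.m) : ℤ := ∑ i, runsAt ω (F.cyc p) i

/-- `Z(ω) = Σ_Q n_Q(ω)`: total run count (geometrically: children on level arcs + NL events of value `ω` — the payer count). -/
noncomputable def Z (ω : ℝ) : ℤ := ∑ p, F.nQ ω p

/-- `POLES`: total number of pole pieces. -/
def poles : ℤ := ∑ p, ∑ i, poleAt (F.cyc p) i

/-- `ASC(ω)`: ascending excursions at level `ω`, all cells. -/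
noncomputable def asc (ω : ℝ) : ℤ := ∑ p, ∑ i, ascAt ω (F.cyc p) i

/-- `DESC(ω)`: descending excursions at level `ω`, all cells. -/
noncomputable def desc (ω : ℝ) : ℤ := ∑ p, ∑ i, descAt ω (F.cyc p) i

/-- `ω` is COVERED: some cell has a run through `ω`. -/
def Covered (ω : ℝ) : Prop :=
  ∃ p : Fin F.m, ∃ i, (F.cyc p).kind i = PieceKind.run ∧ (F.cyc p).start i < ω ∧ (ω : EReal) < (F.cyc p).finish i

/-- PETAL COVER at `ω` for the distinguished cell `pet`: `1 ≤ n_pet(ω)` — the petal alone pays. -/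
def PetalCoverAt (ω : ℝ) (pet : Fin F.m) : Prop := 1 ≤ F.nQ ω pet

/-- (K) `n_Q(ω) ≥ 0`. -/
theorem nQ_nonneg (ω : ℝ) (p : Fin F.m) : 0 ≤ F.nQ ω p := sum_runsAt_nonneg _ ω

/-- ★ (K) DECOMPOSITION IDENTITY (NODE v24 §4): `Z(ω) = POLES + DESC(ω) − ASC(ω)` at every generic level. -/
theorem Z_eq {ω : ℝ} (hg : F.GenericF ω) : F.Z ω = F.poles + F.desc ω - F.asc ω := by
  unfold Z nQ poles desc asc
  rw [← Finset.sum_add_distrib, ← Finset.sum_sub_distrib]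
  exact Finset.sum_congr rfl fun p _ => runs_eq (F.cyc p) (F.chained p) (F.wellFormed p) (hg p)

/-- (K) a run through `ω` in cell `p` makes `n_p(ω) ≥ 1`. -/
theorem one_le_nQ_of_run {ω : ℝ} {p : Fin F.m} {i : Fin (F.sz p + 1)} (hk : (F.cyc p).kind i = PieceKind.run)
    (h1 : (F.cyc p).start i < ω) (h2 : (ω : EReal) < (F.cyc p).finish i) : 1 ≤ F.nQ ω p := by
  have hr : runsAt ω (F.cyc p) i = 1 := by
    unfold runsAt upAt; rw [hk]; simp [PieceKind.isRun, h1, h2]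
  have hle : runsAt ω (F.cyc p) i ≤ F.nQ ω p :=
    Finset.single_le_sum (fun j _ => (runsAt_le_one (F.cyc p) ω j).2) (Finset.mem_univ i)
  linarith

/-- (K) `n_p(ω) ≥ 1` gives a run of cell `p` through `ω`. -/
theorem exists_run_of_one_le_nQ {ω : ℝ} {p : Fin F.m} (h : 1 ≤ F.nQ ω p) :
    ∃ i, (F.cyc p).kind i = PieceKind.run ∧ (F.cyc p).start i < ω ∧ (ω : EReal) < (F.cyc p).finish i := by
  have hpos : ∑ _i : Fin (F.sz p + 1), (0 : ℤ) < ∑ i, runsAt ω (F.cyc p) i := by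
    rw [Finset.sum_const_zero]; unfold nQ at h; linarith
  obtain ⟨i, _, hi⟩ := Finset.exists_lt_of_sum_lt hpos
  exact ⟨i, run_of_runsAt_pos hi⟩

/-- ★ (K) COVER ⟺ `Z ≥ 1`. -/
theorem covered_iff_one_le_Z (ω : ℝ) : F.Covered ω ↔ 1 ≤ F.Z ω := by
  constructor
  · rintro ⟨p, i, hk, h1, h2⟩
    have h := F.one_le_nQ_of_run hk h1 h2
    have hle : F.nQ ω p ≤ F.Z ω := Finset.single_le_sum (fun q _ => F.nQ_nonneg ω q) (Finset.mem_univ p)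
    linarith
  · intro h
    have hpos : ∑ _p : Fin F.m, (0 : ℤ) < ∑ p, F.nQ ω p := by rw [Finset.sum_const_zero]; unfold Z at h; linarith
    obtain ⟨p, _, hp⟩ := Finset.exists_lt_of_sum_lt hpos
    obtain ⟨i, hi⟩ := F.exists_run_of_one_le_nQ (by linarith : 1 ≤ F.nQ ω p)
    exact ⟨p, i, hi⟩

/-- ★ (K) COUNT FORM: `Covered ω ↔ ASC(ω) ≤ POLES − 1 + DESC(ω)` (`#asc − #desc ≤ pz` when `POLES = 1 + pz`). -/
theorem covered_iff_count {ω : ℝ} (hg : F.GenericF ω) : F.Covered ω ↔ F.asc ω ≤ F.poles - 1 + F.desc ω := by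
  rw [F.covered_iff_one_le_Z, F.Z_eq hg]
  constructor <;> intro h <;> linarith

/-- ★ (K) PETAL COVER ⇒ COVER: if the petal alone pays at `ω`, `ω` is covered (the other cells contribute `n_Q ≥ 0`). -/
theorem covered_of_petalCoverAt {ω : ℝ} {pet : Fin F.m} (h : F.PetalCoverAt ω pet) : F.Covered ω := by
  obtain ⟨i, hi⟩ := F.exists_run_of_one_le_nQ h
  exact ⟨pet, i, hi⟩

/-- (K) the petal with one pole: `1 ≤ n_Π(ω) ↔ asc_Π(ω) ≤ desc_Π(ω)`. -/
theorem petalCoverAt_iff {ω : ℝ} (hg : F.GenericF ω) {pet : Fin F.m} (hP : ∑ i, poleAt (F.cyc pet) i = 1) :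
    F.PetalCoverAt ω pet ↔ ∑ i, ascAt ω (F.cyc pet) i ≤ ∑ i, descAt ω (F.cyc pet) i := by
  unfold PetalCoverAt nQ
  rw [runs_eq_of_one_pole (F.cyc pet) (F.chained pet) (F.wellFormed pet) (hg pet) hP]
  constructor <;> intro h <;> linarith

/-- (K) exactness: if no other cell carries a chord or a pole, `Z(ω) = n_Π(ω)`, so cover and petal cover coincide. -/
theorem Z_eq_nQ_of_others {ω : ℝ} (hg : F.GenericF ω) (pet : Fin F.m)
    (hothers : ∀ p, p ≠ pet → ∀ i, (F.cyc p).kind i = PieceKind.run) : F.Z ω = F.nQ ω pet := by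
  unfold Z
  rw [Finset.sum_eq_single pet (fun p _ hp => ?_) (fun h => (h (Finset.mem_univ pet)).elim)]
  have hrun := hothers p hp
  unfold nQ
  rw [runs_eq (F.cyc p) (F.chained p) (F.wellFormed p) (hg p)]
  have h1 : ∑ i, poleAt (F.cyc p) i = 0 := Finset.sum_eq_zero fun i _ => by unfold poleAt; rw [hrun i]; simp [PieceKind.isPole]
  have h2 : ∑ i, descAt ω (F.cyc p) i = 0 := Finset.sum_eq_zero fun i _ => by unfold descAt; rw [hrun i]; simp [PieceKind.isExc]
  have h3 : ∑ i, ascAt ω (F.cyc p) i = 0 := Finset.sum_eq_zero fun i _ => by unfold ascAt; rw [hrun i]; simp [PieceKind.isExc]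
  rw [h1, h2, h3]; simp

end PieceFramework

/-! ## §3 CONJECTURE B, combinatorial half: block descent ⇒ the petal covers every level outside its blocks -/

/-- A BLOCKING of a cycle with `n + 1` pieces whose piece `0` is the pole at `a`: `nb` index blocks `[fst b, lst b]` with `fst b ≠ 0`,
listed in increasing order (`lst b < fst b'` for `b < b'`), such that every piece other than `0` outside all blocks is a run.
(Geometric reading: a block is a maximal group of petal chords joined through interior negative bubbles; the free pieces are the pole
windows and the base-contact / level-arc stretches between blocks.) -/
structure Blocking (c : ValueCycle (n + 1)) where
  /-- number of blocks -/
  nb : ℕ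
  /-- first piece of block `b` -/
  fst : Fin nb → Fin (n + 1)
  /-- last piece of block `b` -/
  lst : Fin nb → Fin (n + 1)
  /-- blocks avoid the pole piece `0` -/
  fst_ne_zero : ∀ b, fst b ≠ 0
  /-- blocks are index intervals -/
  fst_le_lst : ∀ b, fst b ≤ lst b
  /-- blocks are listed in increasing order and are disjoint -/
  lst_lt_fst : ∀ b b', b < b' → lst b < fst b'
  /-- every free piece other than the pole is a run -/
  run_of_free : ∀ i : Fin (n + 1), i ≠ 0 → (∀ b, lst b < i ∨ i < fst b) → c.kind i = PieceKind.run

/-- BLOCK DESCENT (CONJECTURE B read on the blocking): every block ends strictly below where it starts, `B_last(β) < A_first(β)`. -/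
def BlockDescent (c : ValueCycle (n + 1)) (β : Blocking c) : Prop := ∀ b, c.finish (β.lst b) < c.start (β.fst b)

namespace Blocking

variable {c : ValueCycle (n + 1)} (β : Blocking c)

/-- (K) `fst` is monotone. -/
theorem fst_mono {b b' : Fin β.nb} (h : b ≤ b') : β.fst b ≤ β.fst b' := by
  rcases h.lt_or_eq with hlt | heq
  · exact ((β.fst_le_lst b).trans (β.lst_lt_fst b b' hlt).le)
  · rw [heq]

/-- (K) `lst` is monotone. -/
theorem lst_mono {b b' : Fin β.nb} (h : b ≤ b') : β.lst b ≤ β.lst b' := by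
  rcases h.lt_or_eq with hlt | heq
  · exact ((β.lst_lt_fst b b' hlt).le.trans (β.fst_le_lst b'))
  · rw [heq]

end Blocking

/-- (K) TILING: a stretch `[u, v]` of runs, chained, with `start u < ω < finish v` (generic `ω`) contains a run through `ω`. -/
theorem exists_run_of_stretch (c : ValueCycle (n + 1)) (hc : IsChained c) {ω : ℝ} (hg : Generic ω c) (u v : Fin (n + 1)) (huv : u ≤ v)
    (hrun : ∀ i, u ≤ i → i ≤ v → c.kind i = PieceKind.run) (hs : c.start u < ω) (hf : (ω : EReal) < c.finish v) :
    ∃ i, u ≤ i ∧ i ≤ v ∧ c.kind i = PieceKind.run ∧ c.start i < ω ∧ (ω : EReal) < c.finish i := by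
  suffices H : ∀ k : ℕ, ∀ u : Fin (n + 1), v.val - u.val = k → u ≤ v → (∀ i, u ≤ i → i ≤ v → c.kind i = PieceKind.run) →
      c.start u < ω → ∃ i, u ≤ i ∧ i ≤ v ∧ c.kind i = PieceKind.run ∧ c.start i < ω ∧ (ω : EReal) < c.finish i from
    H _ u rfl huv hrun hs
  intro k
  induction k with
  | zero =>
    intro u hk huv hrun hs
    have huv' : u = v := Fin.le_antisymm huv (Fin.le_iff_val_le_val.2 (by omega))
    subst huv'
    exact ⟨u, le_rfl, le_rfl, hrun u le_rfl le_rfl, hs, hf⟩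
  | succ k ih =>
    intro u hk huv hrun hs
    by_cases h1 : (ω : EReal) < c.finish u
    · exact ⟨u, le_rfl, huv, hrun u le_rfl huv, hs, h1⟩
    · have h2 : c.finish u < ω := lt_of_le_of_ne (not_lt.1 h1) (hg u).2.symm
      have hne : u ≠ v := fun h => by subst h; exact h1 hf
      have hul : u.val < v.val := Fin.lt_def.1 (lt_of_le_of_ne huv hne)
      have hu1 : ((u + 1 : Fin (n + 1)) : ℕ) = u.val + 1 :=
        Fin.val_add_one_of_lt (Fin.lt_def.2 (by rw [Fin.val_last]; have := v.isLt; omega))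
      have hs' : c.start (u + 1) < ω := by rw [← hc u]; exact h2
      have hle1 : u ≤ u + 1 := Fin.le_iff_val_le_val.2 (by omega)
      obtain ⟨i, hi1, hi2, hk', hsi, hfi⟩ := ih (u + 1) (by omega) (Fin.le_iff_val_le_val.2 (by omega))
        (fun i h1' h2' => hrun i (hle1.trans h1') h2') hs'
      exact ⟨i, hle1.trans hi1, hi2, hk', hsi, hfi⟩

/-- ★ (K) BLOCK DESCENT ⇒ PETAL COVER (CONJECTURE B ⇒ PCL, combinatorial half; NODE v24 §5): on a chained well-formed cycle whose piece `0` is a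
pole, a blocking with block descent forces every generic level `ω` onto a RUN lying OUTSIDE all blocks (a pole window or an inter-block window). -/
theorem exists_run_of_blockDescent (c : ValueCycle (n + 1)) (hc : IsChained c) (hw : WellFormed c) (h0 : c.kind 0 = PieceKind.pole)
    (β : Blocking c) (hB : BlockDescent c β) {ω : ℝ} (hg : Generic ω c) :
    ∃ i, c.kind i = PieceKind.run ∧ c.start i < ω ∧ (ω : EReal) < c.finish i ∧ ∀ b, β.lst b < i ∨ i < β.fst b := by
  -- the pole piece: `start 0 = ⊤`, `finish 0 = ⊥`; hence `start 1 = ⊥` and `finish (last) = ⊤`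
  obtain ⟨hs0, hf0⟩ := hw.2 0 h0
  have hlast : c.finish (Fin.last n) = ⊤ := by rw [hc (Fin.last n), Fin.last_add_one, hs0]
  have hs1 : c.start 1 = ⊥ := by rw [← zero_add (1 : Fin (n + 1)), ← hc 0, hf0]
  have h1ne : (1 : Fin (n + 1)) ≠ 0 := fun h => by
    have : c.start (0 : Fin (n + 1)) = ⊥ := by rw [← h]; exact hs1
    rw [hs0] at this; exact bot_ne_top this.symm
  -- a stretch `[u, v]` of free pieces with `start u < ω < finish v` yields the conclusion
  have stretch : ∀ u v : Fin (n + 1), u ≠ 0 → u ≤ v → (∀ i, u ≤ i → i ≤ v → ∀ b, β.lst b < i ∨ i < β.fst b) →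
      c.start u < ω → (ω : EReal) < c.finish v →
      ∃ i, c.kind i = PieceKind.run ∧ c.start i < ω ∧ (ω : EReal) < c.finish i ∧ ∀ b, β.lst b < i ∨ i < β.fst b := by
    intro u v hu huv hfree hs hf
    have hrun : ∀ i, u ≤ i → i ≤ v → c.kind i = PieceKind.run := fun i h1 h2 =>
      β.run_of_free i (fun h => hu (Fin.le_antisymm (by rw [← h]; exact h1) (Fin.zero_le _))) (hfree i h1 h2)
    obtain ⟨i, hi1, hi2, hk, hsi, hfi⟩ := exists_run_of_stretch c hc hg u v huv hrun hs hf
    exact ⟨i, hk, hsi, hfi, hfree i hi1 hi2⟩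
  -- generic levels are never endpoint values
  have gen_lt : ∀ j, ¬ c.start j < ω → (ω : EReal) < c.start j := fun j h => lt_of_le_of_ne (not_lt.1 h) (hg j).1
  -- the piece just before a block start `fst b`, as an index `w` with `w + 1 = fst b`
  have pred : ∀ b, ∃ w : Fin (n + 1), w + 1 = β.fst b ∧ w.val + 1 = (β.fst b).val := by
    intro b
    have hpos : 0 < (β.fst b).val := Nat.pos_of_ne_zero fun h => β.fst_ne_zero b (Fin.ext h)
    refine ⟨⟨(β.fst b).val - 1, by have := (β.fst b).isLt; omega⟩, Fin.ext ?_, by simp only; omega⟩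
    rw [Fin.val_add_one_of_lt (Fin.lt_def.2 (by rw [Fin.val_last]; have := (β.fst b).isLt; simp only; omega))]
    simp only; omega
  -- the blocks that start below `ω`
  set T : Finset (Fin β.nb) := Finset.univ.filter fun b => c.start (β.fst b) < ω with hT
  by_cases hTe : T = ∅
  · -- no block starts below `ω`: use the first pole window `[1, fst 0 − 1]` (or `[1, last]` if there are no blocks)
    have hnot : ∀ b, (ω : EReal) < c.start (β.fst b) := fun b => gen_lt (β.fst b) fun h => by
      have : b ∈ T := by rw [hT]; exact Finset.mem_filter.2 ⟨Finset.mem_univ b, h⟩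
      rw [hTe] at this; exact absurd this (Finset.notMem_empty b)
    by_cases hnb : β.nb = 0
    · exact stretch 1 (Fin.last n) h1ne (Fin.le_last _) (fun i _ _ b => absurd b.isLt (by omega))
        (by rw [hs1]; exact EReal.bot_lt_coe ω) (by rw [hlast]; exact EReal.coe_lt_top ω)
    · set b₀ : Fin β.nb := ⟨0, Nat.pos_of_ne_zero hnb⟩ with hb₀
      obtain ⟨w, hw1, hw2⟩ := pred b₀
      have hfw : c.finish w = c.start (β.fst b₀) := by rw [hc w, hw1]
      have hw0 : w ≠ 0 := fun h => by
        have := hnot b₀; rw [← hfw, h, hf0] at this; exact absurd this (not_lt_bot)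
      have h1w : (1 : Fin (n + 1)) ≤ w := Fin.le_iff_val_le_val.2 (by
        rw [Fin.val_one']; have := Nat.pos_of_ne_zero fun h => hw0 (Fin.ext h); have := w.isLt
        rw [Nat.mod_eq_of_lt (by omega)]; omega)
      refine stretch 1 w h1ne h1w (fun i _ hi2 b => Or.inr ?_) (by rw [hs1]; exact EReal.bot_lt_coe ω) (by rw [hfw]; exact hnot b₀)
      have hb : b₀ ≤ b := Fin.le_iff_val_le_val.2 (by rw [hb₀]; exact Nat.zero_le _)
      exact lt_of_lt_of_le (Fin.lt_def.2 (by have := Fin.le_iff_val_le_val.1 hi2; omega)) (β.fst_mono hb)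
  · -- `b⋆` = the last block starting below `ω`; block descent puts its end below `ω` too
    have hTn : T.Nonempty := Finset.nonempty_iff_ne_empty.2 hTe
    set bs := T.max' hTn with hbs
    have hbsT : bs ∈ T := Finset.max'_mem T hTn
    have hbs1 : c.start (β.fst bs) < ω := by rw [hT] at hbsT; exact (Finset.mem_filter.1 hbsT).2
    have hbs2 : c.finish (β.lst bs) < ω := (hB bs).trans hbs1
    have hlstlt : β.lst bs < Fin.last n := lt_of_le_of_ne (Fin.le_last _) fun h => by
      have := hB bs; rw [h, hlast] at this; exact absurd this not_top_lt
    have hu : ((β.lst bs + 1 : Fin (n + 1)) : ℕ) = (β.lst bs).val + 1 := Fin.val_add_one_of_lt hlstlt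
    have hune : (β.lst bs + 1 : Fin (n + 1)) ≠ 0 := fun h => by
      have := congrArg Fin.val h; rw [hu, Fin.val_zero] at this; omega
    have hsu : c.start (β.lst bs + 1) < ω := by rw [← hc (β.lst bs)]; exact hbs2
    by_cases hl : bs.val + 1 = β.nb
    · -- `b⋆` is the last block: use the final pole window `[lst b⋆ + 1, last]`
      refine stretch (β.lst bs + 1) (Fin.last n) hune (Fin.le_last _) (fun i hi1 _ b => Or.inl ?_) hsu
        (by rw [hlast]; exact EReal.coe_lt_top ω)
      have hb : b ≤ bs := Fin.le_iff_val_le_val.2 (by have := b.isLt; omega)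
      exact lt_of_le_of_lt (β.lst_mono hb) (Fin.lt_def.2 (by have := Fin.le_iff_val_le_val.1 hi1; omega))
    · -- the next block `b'` starts above `ω`: use the inter-block window `[lst b⋆ + 1, fst b' − 1]`
      set b' : Fin β.nb := ⟨bs.val + 1, by have := bs.isLt; omega⟩ with hb'
      have hb'T : b' ∉ T := fun h => by
        have := Finset.le_max' T b' h
        rw [← hbs, Fin.le_iff_val_le_val, hb'] at this; simp only at this; omega
      have hb's : (ω : EReal) < c.start (β.fst b') := gen_lt (β.fst b') fun h => hb'T (by rw [hT]; exact Finset.mem_filter.2 ⟨Finset.mem_univ _, h⟩)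
      obtain ⟨w, hw1, hw2⟩ := pred b'
      have hfw : c.finish w = c.start (β.fst b') := by rw [hc w, hw1]
      have hord : β.lst bs < β.fst b' := β.lst_lt_fst bs b' (Fin.lt_def.2 (by rw [hb']; simp only; omega))
      have hadj : (β.lst bs).val + 1 ≠ (β.fst b').val := fun h => by
        have heq : β.lst bs + 1 = β.fst b' := Fin.ext (by rw [hu, h])
        have := hb's; rw [← heq, ← hc (β.lst bs)] at this
        exact absurd (hbs2.trans this) (lt_irrefl _)
      have huw : β.lst bs + 1 ≤ w := Fin.le_iff_val_le_val.2 (by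
        rw [hu]; have := Fin.lt_def.1 hord; omega)
      refine stretch (β.lst bs + 1) w hune huw (fun i hi1 hi2 b => ?_) hsu (by rw [hfw]; exact hb's)
      by_cases hbb : b.val ≤ bs.val
      · exact Or.inl (lt_of_le_of_lt (β.lst_mono (Fin.le_iff_val_le_val.2 hbb))
          (Fin.lt_def.2 (by have := Fin.le_iff_val_le_val.1 hi1; omega)))
      · refine Or.inr (lt_of_lt_of_le (Fin.lt_def.2 ?_) (β.fst_mono (Fin.le_iff_val_le_val.2 (by rw [hb']; simp only; omega) : b' ≤ b)))
        have := Fin.le_iff_val_le_val.1 hi2; omega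

end RhW08.Lens1PieceFramework
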